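import Summits.ResolutionOfSingularities.ResolutionOfSingularities.Theorems.RadicialJungCleanModelsReadOffCriticalPrincipal
import Summits.ResolutionOfSingularities.ResolutionOfSingularities.Theorems.RadicialJungCleanModelsPBasisStalk
import Summits.ResolutionOfSingularities.ResolutionOfSingularities.Theorems.RadicialJungCleanModelsGiraudChartAtPoint
import Summits.ResolutionOfSingularities.ResolutionOfSingularities.Theorems.RadicialJungCleanModelsCriticalSetClosed
import Literature.AlgebraicGeometry.Resolution.AlterationsBoundarySmoothLocus
import Literature.AlgebraicGeometry.Resolution.RegularFormallySmoothPrimeField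
import Literature.AlgebraicGeometry.Resolution.MarkedIdeals
import HarnessLib

/-!
# [OURS · L W8.1 · T2 brick B7 — THE CLOSER] `stub_readOff_critical`: at a closed point of `E(f)` with
# strict normal crossings and `c = 0`, the germ of `f` is in Giraud's normal form

Programme `PROGRAMME-clean-dim2` / T2; crux stmt-ResolutionOfSingularities-15917, skeleton
`HOME/L/res-L0-w81-pv-2/g5/T2Skeleton.lean` v3 (sha16 eba771a359cfc80d), stub `stub_readOff_critical`
(B7); spec `HOME/L/res-L0-w81-pv-2/g5/B7-SPEC.md` parts (1)–(6). `--supports … --as helper`.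
OURS; AI-written, weaker than expert review; nothing here is a statement of H. Hironaka's manuscript.

* § 1 (spec part (1), at the stalk) **`exists_rsop_derivCriticalPrimes_iff`** — for `X` regular,
  integral, locally of finite type over a field of characteristic `p`, `f ∈ Γ(X, 𝒪_X)` and a point `ξ`
  where `E(f)` (`derivCriticalSet`) has strict normal crossings (`IsStrictNormalCrossingsAt`): the SNC
  regular system of parameters `(x ; y)` of `𝒪_{X,ξ}` (`I(E)_ξ = (x_1 ⋯ x_r)`) satisfies
  «`P ∈ derivCriticalPrimes 𝒪_{X,ξ} f_ξ ↔ ∃ j, P = (x_j)`». Proof on an affine chart `U ∋ ξ` with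
  `Ω[Γ(X,U)⁄ℤ]` projective (`projective_kaehler_sections_of_isAffineOpen`): a critical prime contracts
  to a height-one prime `𝔭 ⊇ J(Γ(U), f)` (`under_mem_of_mem_derivCriticalPrimes`), hence `𝔭 ⊇ I(E)(U)`
  (`derivJacobianIdeal_le_prime_iff_vanishingIdeal_le`), so `x_1 ⋯ x_r ∈ P` and `P = (x_j)` by height
  one; conversely `(x_j) ⊇ I(E)_ξ` extends from a height-one prime over `J(Γ(U), f)`
  (`map_mem_derivCriticalPrimes`). No chart shrinking and no dual derivations are needed at one stalk.
* § 2 plumbing: `not_mem_range_frobenius_germ_of_functionField` (`hf` ⇒ `f_ξ ∉ 𝒪_{X,ξ}^p` via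
  `stalkSpecializes` to the generic point) and `formallySmooth_zmod_stalk` (the stalk is formally smooth
  over `𝔽_p`: `formallySmooth_zmod_of_isRegularLocalRing_of_essFiniteType` through a chart).
* § 3 **`giraud15NormalFormAt_readOff_critical`** — the binders of `stub_readOff_critical` VERBATIM ⊢
  `Giraud15NormalFormAt p (X.presheaf.germ ⊤ ξ trivial f)`: § 1 gives `r ∈ {1, 2}` (`dim 𝒪_{X,ξ} = 2`
  by `ringKrullDim_stalk_eq_of_isClosed`), the `p`-basis `Γ ∋ x, y` is res-L0-w81-pv-2's
  `exists_isPBasisOver_stalk`, and `giraud15NormalFormAt_of_criticalPrimes_eq₂` (crossing, `r = 2`) /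
  `…_eq₁` (`r = 1`) of `…ReadOffCriticalPrincipal` (parts (2)–(6)) conclude.

References: J. Giraud, Bull. SMF 111 (1983), Prop. 1.5, 1.3, 2.2, 2.5 [Giraud1983].
-/

noncomputable section

set_option linter.dupNamespace false -- mandated namespace of this single-conjunct summit

open CategoryTheory AlgebraicGeometry TopologicalSpace IsLocalRing Opposite
open Literature.RingTheory.PBasis Literature.AlgebraicGeometry.Resolution
open AlgebraicGeometry.Scheme.IdealSheafData

namespace Summit.ResolutionOfSingularities.ResolutionOfSingularities.Theorems.RadicialJung.CleanModels

/-! ## § 1 The critical primes of the stalk at a strict-normal-crossings point of `E(f)` -/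

/-- **Spec part (1): at a point of `E(f)` with strict normal crossings, the critical primes of
`𝒪_{X,ξ}` at `f` are exactly the branches `(x_j)` of the SNC regular system of parameters.**
[cite: Giraud1983, Déf. 1.2 and 1.3] -/
theorem exists_rsop_derivCriticalPrimes_iff (p : ℕ) [Fact p.Prime] (k : Type) [Field k] [CharP k p]
    {X : Scheme.{0}} [IsIntegral X] (q : X ⟶ Spec (.of k)) [LocallyOfFiniteType q]
    (hreg : Scheme.IsRegular X) (f : Γ(X, ⊤)) {ξ : X}
    (hsnc : IsStrictNormalCrossingsAt X (derivCriticalSet X f) ξ) :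
    ∃ (r e : ℕ) (x : Fin r → X.presheaf.stalk ξ) (y : Fin e → X.presheaf.stalk ξ),
      1 ≤ r ∧ ringKrullDim (X.presheaf.stalk ξ) = (r + e : ℕ) ∧
      Ideal.span (Set.range x ∪ Set.range y) = maximalIdeal (X.presheaf.stalk ξ) ∧
      ∀ P : Ideal (X.presheaf.stalk ξ),
        P ∈ derivCriticalPrimes (X.presheaf.stalk ξ) (X.presheaf.germ ⊤ ξ trivial f) ↔
          ∃ j, P = Ideal.span {x j} := by
  classical
  haveI : IsLocallyNoetherian X := LocallyOfFiniteType.isLocallyNoetherian q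
  have hE : IsClosed (derivCriticalSet X f) := isClosed_derivCriticalSet p q hreg f
  have hCl : (⟨closure (derivCriticalSet X f), isClosed_closure⟩ : Closeds X) =
      ⟨derivCriticalSet X f, hE⟩ := Closeds.ext hE.closure_eq
  -- the strict normal crossings data at `ξ`
  obtain ⟨hRO, r, e, x, y, h1r, hdimO, hspan, hIst⟩ := hsnc
  haveI := hRO
  haveI : IsDomain (X.presheaf.stalk ξ) := isDomain_of_isRegularLocalRing _
  have hxP := isPrime_and_height_eq_one_of_rsop x y hdimO hspan
  refine ⟨r, e, x, y, h1r, hdimO, hspan, ?_⟩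
  -- an affine chart `U ∋ ξ` with projective Kähler differentials
  obtain ⟨_, ⟨U, hU, rfl⟩, hξU, -⟩ :=
    X.isBasis_affineOpens.exists_subset_of_mem_open (Set.mem_univ ξ) isOpen_univ
  letI := TopCat.Presheaf.algebra_section_stalk X.presheaf (⟨ξ, hξU⟩ : U)
  haveI := hU.isLocalization_stalk ⟨ξ, hξU⟩
  haveI := projective_kaehler_sections_of_isAffineOpen p k q hreg hU
  set 𝔮 := (hU.primeIdealOf ⟨ξ, hξU⟩).asIdeal with h𝔮
  -- `f` on the chart and its germ
  set fU : Γ(X, U) := X.presheaf.map (homOfLE le_top).op f with hfU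
  have hgerm : algebraMap Γ(X, U) (X.presheaf.stalk ξ) fU = X.presheaf.germ ⊤ ξ trivial f :=
    X.presheaf.germ_res_apply (homOfLE le_top) _ hξU f
  -- the ideal of `E(f)` on `U` extends to `I(E)_ξ = (x_1 ⋯ x_r)`
  set IU : Ideal Γ(X, U) := (vanishingIdeal ⟨derivCriticalSet X f, hE⟩).ideal ⟨U, hU⟩ with hIU
  have hImap : IU.map (algebraMap Γ(X, U) (X.presheaf.stalk ξ)) = Ideal.span {∏ i, x i} := by
    rw [hIU, ← hCl, ← hIst, stalkIdeal_eq_map_germ _ ⟨U, hU⟩ hξU]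
    rfl
  intro P
  constructor
  · intro hP
    rw [← hgerm] at hP
    haveI : P.IsPrime := hP.1
    have hPht : P.height = 1 := hP.2.1
    obtain ⟨hpr, hht, hJ, -, hmap⟩ := under_mem_of_mem_derivCriticalPrimes 𝔮 (X.presheaf.stalk ξ) fU hP
    have hI : IU ≤ P.under Γ(X, U) :=
      (derivJacobianIdeal_le_prime_iff_vanishingIdeal_le hU f hE ⟨P.under Γ(X, U), hpr⟩).mp hJ
    have hprod : ∏ i, x i ∈ P := by
      have h1 : Ideal.span {∏ i, x i} ≤ P := by
        rw [← hImap, ← hmap]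
        exact Ideal.map_mono hI
      exact h1 (Ideal.mem_span_singleton_self _)
    obtain ⟨j, -, hj⟩ := Ideal.IsPrime.prod_mem_iff.mp hprod
    refine ⟨j, ?_⟩
    obtain ⟨-, hjpr, hjht⟩ := hxP j
    haveI := hjpr
    have hle : Ideal.span {x j} ≤ P := (Ideal.span_singleton_le_iff_mem _).mpr hj
    by_contra hne
    have hlt : Ideal.span {x j} < P := lt_of_le_of_ne hle (Ne.symm hne)
    haveI : P.FiniteHeight := P.finiteHeight_iff.mpr (Or.inr (by rw [hPht]; exact ENat.one_ne_top))
    have := Ideal.height_strict_mono_of_isPrime_of_isPrime hlt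
    rw [hjht, hPht] at this
    exact lt_irrefl _ this
  · rintro ⟨j, rfl⟩
    obtain ⟨-, hjpr, hjht⟩ := hxP j
    haveI := hjpr
    -- the contraction `𝔭 = (x_j) ∩ Γ(X, U)`
    have hht : ((Ideal.span {x j}).under Γ(X, U)).height = 1 := by
      rw [IsLocalization.height_under 𝔮.primeCompl]; exact hjht
    have hJ : derivJacobianIdeal Γ(X, U) fU ≤ (Ideal.span {x j}).under Γ(X, U) := by
      refine (derivJacobianIdeal_le_prime_iff_vanishingIdeal_le hU f hE
        ⟨(Ideal.span {x j}).under Γ(X, U), inferInstance⟩).mpr fun a ha => ?_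
      change algebraMap Γ(X, U) (X.presheaf.stalk ξ) a ∈ Ideal.span {x j}
      have h1 : algebraMap Γ(X, U) (X.presheaf.stalk ξ) a ∈ Ideal.span {∏ i, x i} :=
        hImap ▸ Ideal.mem_map_of_mem _ ha
      exact Ideal.span_singleton_le_span_singleton.mpr
        (Finset.dvd_prod_of_mem x (Finset.mem_univ j)) h1
    have hle : (Ideal.span {x j}).under Γ(X, U) ≤ 𝔮 := by
      rw [h𝔮, ← IsLocalization.AtPrime.under_maximalIdeal (X.presheaf.stalk ξ)
        (hU.primeIdealOf ⟨ξ, hξU⟩).asIdeal]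
      exact Ideal.comap_mono (le_maximalIdeal hjpr.ne_top)
    have h := map_mem_derivCriticalPrimes 𝔮 (X.presheaf.stalk ξ) fU hht hJ hle
    rwa [IsLocalization.map_under 𝔮.primeCompl, hgerm] at h

/-! ## § 2 Plumbing at the stalk: `f_ξ ∉ 𝒪^p`, formal smoothness over `𝔽_p` -/

/-- If `f` is not a `p`-th power in the function field, its germ at any point is not a `p`-th power
in the stalk (push a `p`-th root to the generic point with `stalkSpecializes`). [folklore] -/
theorem not_mem_range_frobenius_germ (p : ℕ) [Fact p.Prime] {X : Scheme.{0}} [IsIntegral X]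
    (f : Γ(X, ⊤)) (hf : ∀ c : X.functionField, c ^ p ≠ X.presheaf.germ ⊤ (genericPoint X) trivial f)
    (ξ : X) [CharP (X.presheaf.stalk ξ) p] :
    X.presheaf.germ ⊤ ξ trivial f ∉ (frobenius (X.presheaf.stalk ξ) p).range := by
  rintro ⟨g, hg⟩
  apply hf ((X.presheaf.stalkSpecializes (genericPoint_specializes ξ)).hom g)
  rw [← map_pow, ← frobenius_def, hg, ← CommRingCat.comp_apply,
    TopCat.Presheaf.germ_stalkSpecializes]

/-- **The stalk of a regular scheme locally of finite type over a field of characteristic `p` is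
formally smooth over `𝔽_p`** (for any — the unique — `𝔽_p`-algebra structure): it is essentially of
finite type over `k` through an affine chart, and regular. [cite: Matsumura1987, Thm. 30.6 (ii)] -/
theorem formallySmooth_zmod_stalk (p : ℕ) [Fact p.Prime] (k : Type) [Field k] [CharP k p]
    {X : Scheme.{0}} (q : X ⟶ Spec (.of k)) [LocallyOfFiniteType q] (hreg : Scheme.IsRegular X)
    (ξ : X) [Algebra (ZMod p) (X.presheaf.stalk ξ)] :
    Algebra.FormallySmooth (ZMod p) (X.presheaf.stalk ξ) := by
  obtain ⟨_, ⟨U, hU, rfl⟩, hξU, -⟩ :=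
    X.isBasis_affineOpens.exists_subset_of_mem_open (Set.mem_univ ξ) isOpen_univ
  letI := TopCat.Presheaf.algebra_section_stalk X.presheaf (⟨ξ, hξU⟩ : U)
  haveI := hU.isLocalization_stalk ⟨ξ, hξU⟩
  -- the chart ring is of finite type over `k`
  let φ : CommRingCat.of k ⟶ Γ(X, U) := (Scheme.ΓSpecIso (.of k)).inv ≫ q.appLE ⊤ U le_top
  letI : Algebra k Γ(X, U) := φ.hom.toAlgebra
  haveI : Algebra.FiniteType k Γ(X, U) := by
    have h1 : RingHom.FiniteType (q.appLE ⊤ U le_top).hom :=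
      HasRingHomProperty.appLE @LocallyOfFiniteType q ‹_› ⟨⊤, isAffineOpen_top _⟩ ⟨U, hU⟩ le_top
    have h2 : RingHom.FiniteType φ.hom := by
      rw [CommRingCat.hom_comp]
      exact h1.comp (RingHom.FiniteType.of_surjective _
        (Scheme.ΓSpecIso (.of k)).commRingCatIsoToRingEquiv.symm.surjective)
    exact h2
  letI : Algebra k (X.presheaf.stalk ξ) :=
    ((algebraMap Γ(X, U) (X.presheaf.stalk ξ)).comp (algebraMap k Γ(X, U))).toAlgebra
  haveI : IsScalarTower k Γ(X, U) (X.presheaf.stalk ξ) :=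
    IsScalarTower.of_algebraMap_eq (fun _ => rfl)
  haveI : Algebra.EssFiniteType Γ(X, U) (X.presheaf.stalk ξ) :=
    Algebra.EssFiniteType.of_isLocalization (X.presheaf.stalk ξ)
      (hU.primeIdealOf ⟨ξ, hξU⟩).asIdeal.primeCompl
  haveI : Algebra.EssFiniteType k (X.presheaf.stalk ξ) :=
    Algebra.EssFiniteType.comp k Γ(X, U) (X.presheaf.stalk ξ)
  haveI : IsRegularLocalRing (X.presheaf.stalk ξ) := hreg ξ
  exact formallySmooth_zmod_of_isRegularLocalRing_of_essFiniteType p k (X.presheaf.stalk ξ)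

/-! ## § 3 The closer of `stub_readOff_critical` -/

/-- Two generators listed as `Fin 1 ⊕ Fin 1` span the same ideal as the pair. [folklore] -/
theorem span_range_union_range_fin_one {O : Type*} [CommRing O] (x y : Fin 1 → O) :
    Ideal.span (Set.range x ∪ Set.range y) = Ideal.span {x 0, y 0} := by
  apply le_antisymm
  · refine Ideal.span_le.mpr ?_
    rintro _ (⟨i, rfl⟩ | ⟨j, rfl⟩)
    · rw [Subsingleton.elim i 0]; exact Ideal.subset_span (by simp)
    · rw [Subsingleton.elim j 0]; exact Ideal.subset_span (by simp)
  · refine Ideal.span_le.mpr ?_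
    rintro _ (rfl | rfl)
    · exact Ideal.subset_span (Or.inl ⟨0, rfl⟩)
    · exact Ideal.subset_span (Or.inr ⟨0, rfl⟩)

/-- Two generators listed as `Fin 2 ⊕ Fin 0` span the same ideal as the pair. [folklore] -/
theorem span_range_union_range_fin_two {O : Type*} [CommRing O] (x : Fin 2 → O) (y : Fin 0 → O) :
    Ideal.span (Set.range x ∪ Set.range y) = Ideal.span {x 0, x 1} := by
  apply le_antisymm
  · refine Ideal.span_le.mpr ?_
    rintro _ (⟨i, rfl⟩ | ⟨j, -⟩)
    · rcases Fin.exists_fin_two.mp ⟨i, rfl⟩ with h | h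
      · rw [← h]; exact Ideal.subset_span (by simp)
      · rw [← h]; exact Ideal.subset_span (by simp)
    · exact Fin.elim0 j
  · refine Ideal.span_le.mpr ?_
    rintro _ (rfl | rfl)
    · exact Ideal.subset_span (Or.inl ⟨0, rfl⟩)
    · exact Ideal.subset_span (Or.inl ⟨1, rfl⟩)

/-- **B7 — `stub_readOff_critical` of the T2 skeleton (v3), with its binders verbatim.** For `X`
regular, integral, two-dimensional, locally of finite type over a field `k` of characteristic `p`,
`f ∈ Γ(X, 𝒪_X)` not a `p`-th power in the function field, and a CLOSED point `ξ ∈ E(f)` where `E(f)`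
has strict normal crossings and Giraud's colength `c(X, f, ξ)` vanishes, the germ `f_ξ` is in
Giraud's normal form `Giraud15NormalFormAt p f_ξ` (Giraud 1983, Prop. 1.5 (i) ⇒ (ii) at a point where
(**) holds). Assembly of spec parts (1) [§ 1], (2)+(6) [`…ReadOffCriticalPrincipal`], (3)
[res-L1-s13-pv-1's `…ReadOffCriticalRealiser`], (4) [`…ReadOffCriticalMaximiser`], (5)
[`…ReadOffCriticalExponents`], with the `p`-basis of res-L0-w81-pv-2's `exists_isPBasisOver_stalk`.
[cite: Giraud1983, Prop. 1.5 and 2.2] -/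
theorem giraud15NormalFormAt_readOff_critical (p : ℕ) [Fact p.Prime] (k : Type) [Field k]
    [CharP k p] (X : Scheme.{0}) [IsIntegral X] (q : X ⟶ Spec (.of k)) [LocallyOfFiniteType q]
    (hreg : Scheme.IsRegular X) (hdim : topologicalKrullDim X = 2) (f : Γ(X, ⊤))
    (hf : ∀ c : X.functionField, c ^ p ≠ X.presheaf.germ ⊤ (genericPoint X) trivial f)
    (ξ : X) (hξ : IsClosed ({ξ} : Set X)) (hξE : ξ ∈ derivCriticalSet X f)
    (hsnc : IsStrictNormalCrossingsAt X (derivCriticalSet X f) ξ)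
    (hc : giraudColength (X.presheaf.stalk ξ) (X.presheaf.germ ⊤ ξ trivial f) = 0) :
    Giraud15NormalFormAt p (X.presheaf.germ ⊤ ξ trivial f) := by
  classical
  -- `hξE` is part of the registered stub signature (it also follows from `hsnc`); record it as used.
  have _ := hξE
  haveI : IsRegularLocalRing (X.presheaf.stalk ξ) := hreg ξ
  -- characteristic `p` on the stalk, through `k → Γ(X, ⊤) → 𝒪_{X,ξ}`
  haveI : CharP (X.presheaf.stalk ξ) p := by
    let ψ : k →+* X.presheaf.stalk ξ := (X.presheaf.germ ⊤ ξ trivial).hom.comp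
      (q.appTop.hom.comp (Scheme.ΓSpecIso (.of k)).inv.hom)
    exact charP_of_injective_ringHom ψ.injective p
  letI : Algebra (ZMod p) (X.presheaf.stalk ξ) := ZMod.algebra _ p
  haveI := formallySmooth_zmod_stalk p k q hreg ξ
  have hdim2 : ringKrullDim (X.presheaf.stalk ξ) = 2 := by
    rw [ringKrullDim_stalk_eq_of_isClosed q hξ, hdim]
  have hfp := not_mem_range_frobenius_germ p f hf ξ
  -- the SNC regular system of parameters and the critical primes (part (1))
  obtain ⟨r, e, x, y, h1r, hdimO, hspan, hcrit⟩ :=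
    exists_rsop_derivCriticalPrimes_iff p k q hreg f hsnc
  have hre : r + e = 2 := by
    have h := hdimO.symm.trans hdim2
    exact_mod_cast h
  -- a `p`-basis of the stalk containing `(x ; y)`
  have hz := (span_range_append x y).trans hspan
  obtain ⟨Γ, hsub, hΓ⟩ := exists_isPBasisOver_stalk p k q hreg hξ (Fin.append x y) hz hdimO
  have hxΓ : ∀ i, x i ∈ Γ := fun i => hsub ⟨Fin.castAdd e i, Fin.append_left x y i⟩
  have hyΓ : ∀ j, y j ∈ Γ := fun j => hsub ⟨Fin.natAdd r j, Fin.append_right x y j⟩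
  rcases (show r = 1 ∨ r = 2 by omega) with hr | hr
  · -- ONE branch through `ξ`: `(x₀ ; y₀)`
    subst hr
    obtain rfl : e = 1 := by omega
    have hxy : Ideal.span {x 0, y 0} = maximalIdeal (X.presheaf.stalk ξ) := by
      rw [← span_range_union_range_fin_one x y]; exact hspan
    have hcrit₁ : ∀ P : Ideal (X.presheaf.stalk ξ),
        P ∈ derivCriticalPrimes (X.presheaf.stalk ξ) (X.presheaf.germ ⊤ ξ trivial f) ↔
          P = Ideal.span {x 0} := fun P =>
      (hcrit P).trans Fin.exists_fin_one
    exact giraud15NormalFormAt_of_criticalPrimes_eq₁ p hdim2 hΓ (hxΓ 0) hxy hcrit₁ hfp hc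
  · -- TWO branches through `ξ` (crossing point): `(x₀, x₁ ; ∅)`
    subst hr
    obtain rfl : e = 0 := by omega
    have hxy : Ideal.span {x 0, x 1} = maximalIdeal (X.presheaf.stalk ξ) := by
      rw [← span_range_union_range_fin_two x y]; exact hspan
    have hcrit₂ : ∀ P : Ideal (X.presheaf.stalk ξ),
        P ∈ derivCriticalPrimes (X.presheaf.stalk ξ) (X.presheaf.germ ⊤ ξ trivial f) ↔
          (P = Ideal.span {x 0} ∨ P = Ideal.span {x 1}) := fun P =>
      (hcrit P).trans Fin.exists_fin_two
    exact giraud15NormalFormAt_of_criticalPrimes_eq₂ p hdim2 hΓ (hxΓ 0) (hxΓ 1) hxy hcrit₂ hfp hc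

end Summit.ResolutionOfSingularities.ResolutionOfSingularities.Theorems.RadicialJung.CleanModels

end
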